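import Mathlib
import Literature.Computability.AlgebraicComplexity.HessianAtOrigin
import Literature.Computability.AlgebraicComplexity.MignonRessayreBound
import Literature.Computability.AlgebraicComplexity.LRPencilOfMatrix
import Literature.Computability.AlgebraicComplexity.LandsbergRessayreNormalForm
import Summits.ValiantsHypothesis.ValiantsHypothesis.Theses.RefutationDegree

/-!
# Conjugation / translation bookkeeping for affine matrices (line `Sketch`, crux `BeyondHessianNs`)

Helper file for crux item stmt-ValiantsHypothesis-5641 (`RefutationDegree.BeyondHessianNs`),
stub `stub_conj_transl` of the line `Sketch`.

For a square matrix `A` of AFFINE linear forms (entries of total degree `≤ 1`), a point `x` and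
constant matrices `V, U`, put `B := V · A(X + x) · U`
(`V.map C * A.map (transl x) * U.map C`).  Then

* `B` is again affine (`totalDegree_transl_le`, products with constants);
* `det B = (det V · det U) · (det A)(X + x)` (`Matrix.det_mul`, `RingHom.map_det`,
  `AlgHom.map_det`);
* `B(0) = constPart B = V · A(x) · U` (`constPart_mul`, `constPart_map_C`,
  `constantCoeff_transl`);
* the constant part of the ORIGINAL matrix is recovered as
  `V · A(0) · U = B(0) - Σ_w x_w • B_w` with `B_w = coeffMat B w`: evaluate `B` at `-x`
  (`B(-x) = V · A(0) · U` since `(transl x f)(-x) = f(0)`) and use the affine expansion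
  `B(v) = B(0) + Σ_w v_w • B_w` (`LRPencil.map_eval_eq`).
-/

noncomputable section

-- `Summit.ValiantsHypothesis.ValiantsHypothesis.…` is the tree's mandated single-conjunct layout.
set_option linter.dupNamespace false

namespace Summit.ValiantsHypothesis.ValiantsHypothesis.Theorems.RefutationDegreeBeyondHessianNs

open MvPolynomial Matrix
open Literature.Computability.AlgebraicComplexity

section TranslEval

variable {k : Type*} [CommRing k] {σ : Type*}

/-- Shifted evaluation: `f(X + x)(v) = f(v + x)`. [folklore] -/
theorem eval_transl (x v : σ → k) (f : MvPolynomial σ k) :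
    eval v (transl x f) = eval (v + x) f := by
  induction f using MvPolynomial.induction_on with
  | C a => simp
  | add p q hp hq => simp only [map_add, hp, hq]
  | mul_X p j hp => simp [hp, transl_X, Pi.add_apply]

/-- Evaluating the translate at `-x` gives the constant term: `f(X + x)(-x) = f(0)`. [folklore] -/
theorem eval_neg_transl (x : σ → k) (f : MvPolynomial σ k) :
    eval (-x) (transl x f) = constantCoeff f := by
  rw [eval_transl, neg_add_cancel, MvPolynomial.eval_zero]

end TranslEval

section ConstMul

variable {k : Type*} [CommRing k] {σ : Type*} {ι : Type*}

/-- Left multiplication by a constant matrix keeps a matrix of affine linear forms affine.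
[folklore] -/
theorem totalDegree_map_C_mul_le [Fintype ι] (V : Matrix ι ι k)
    (M : Matrix ι ι (MvPolynomial σ k)) {d : ℕ} (hM : ∀ i j, (M i j).totalDegree ≤ d)
    (i j : ι) :
    ((V.map (C : k →+* MvPolynomial σ k) * M) i j).totalDegree ≤ d := by
  rw [Matrix.mul_apply]
  refine totalDegree_finsetSum_le fun l _ => ?_
  rw [Matrix.map_apply]
  refine (totalDegree_mul _ _).trans ?_
  rw [totalDegree_C, zero_add]
  exact hM l j

/-- Right multiplication by a constant matrix keeps a matrix of affine linear forms affine.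
[folklore] -/
theorem totalDegree_mul_map_C_le [Fintype ι] (M : Matrix ι ι (MvPolynomial σ k))
    (U : Matrix ι ι k) {d : ℕ} (hM : ∀ i j, (M i j).totalDegree ≤ d) (i j : ι) :
    ((M * U.map (C : k →+* MvPolynomial σ k)) i j).totalDegree ≤ d := by
  rw [Matrix.mul_apply]
  refine totalDegree_finsetSum_le fun l _ => ?_
  rw [Matrix.map_apply]
  refine (totalDegree_mul _ _).trans ?_
  rw [totalDegree_C, add_zero]
  exact hM i l

/-- The constant part of the translate `A(X + x)` is the value `A(x)`. [folklore] -/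
theorem constPart_map_transl (x : σ → k) (A : Matrix ι ι (MvPolynomial σ k)) :
    constPart (A.map (transl x)) = A.map (eval x) := by
  ext i j
  rw [constPart_apply, Matrix.map_apply, Matrix.map_apply, constantCoeff_transl]

/-- Evaluating the translate `A(X + x)` at `-x` gives the constant part `A(0)`. [folklore] -/
theorem map_transl_map_eval_neg (x : σ → k) (A : Matrix ι ι (MvPolynomial σ k)) :
    (A.map (transl x)).map (eval (-x)) = constPart A := by
  ext i j
  rw [Matrix.map_apply, Matrix.map_apply, constPart_apply, eval_neg_transl]

/-- Evaluating a constant matrix `V.map C` gives back `V`. [folklore] -/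
theorem map_C_map_eval (v : σ → k) (V : Matrix ι ι k) :
    (V.map (C : k →+* MvPolynomial σ k)).map (eval v) = V := by
  ext i j
  rw [Matrix.map_apply, Matrix.map_apply, eval_C]

end ConstMul

/-- **Conjugation / translation bookkeeping** (stub `stub_conj_transl` of the line `Sketch`): for
`A` affine, a point `x` and constant matrices `V, U`, the matrix `B = V · A(X + x) · U` is affine,
`det B = (det V det U) · (det A)(X + x)`, `B(0) = V A(x) U`, and the constant part of `A` is
recovered as `V A(0) U = B(0) - Σ_w x_w B_w` (`B_w = coeffMat B w`; evaluate `B` at `-x`).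
[folklore] -/
theorem stub_conj_transl {K : Type*} [Field K] {ι : Type*} [Fintype ι] [DecidableEq ι]
    {o : Type*} [Fintype o] [DecidableEq o] (A : Matrix o o (MvPolynomial ι K))
    (hA : ∀ i j, (A i j).totalDegree ≤ 1) (x : ι → K) (V U : Matrix o o K) :
    (∀ i j, ((V.map (C : K →+* MvPolynomial ι K) * A.map (transl x) *
      U.map (C : K →+* MvPolynomial ι K)) i j).totalDegree ≤ 1) ∧
    (V.map (C : K →+* MvPolynomial ι K) * A.map (transl x) *
      U.map (C : K →+* MvPolynomial ι K)).det = C (V.det * U.det) * transl x A.det ∧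
    constPart (V.map (C : K →+* MvPolynomial ι K) * A.map (transl x) *
      U.map (C : K →+* MvPolynomial ι K)) = V * A.map (eval x) * U ∧
    V * constPart A * U = constPart (V.map (C : K →+* MvPolynomial ι K) * A.map (transl x) *
      U.map (C : K →+* MvPolynomial ι K)) -
      ∑ w, x w • LRPencil.coeffMat (V.map (C : K →+* MvPolynomial ι K) * A.map (transl x) *
        U.map (C : K →+* MvPolynomial ι K)) w := by
  set B : Matrix o o (MvPolynomial ι K) :=
    V.map (C : K →+* MvPolynomial ι K) * A.map (transl x) * U.map (C : K →+* MvPolynomial ι K)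
    with hB
  -- (1) `B` is affine.
  have hAx : ∀ i j, (A.map (transl x) i j).totalDegree ≤ 1 := fun i j => by
    rw [Matrix.map_apply]
    exact (totalDegree_transl_le _ _).trans (hA i j)
  have hBdeg : ∀ i j, (B i j).totalDegree ≤ 1 := fun i j =>
    totalDegree_mul_map_C_le _ U (totalDegree_map_C_mul_le V _ hAx) i j
  -- (2) the determinant.
  have hBdet : B.det = C (V.det * U.det) * transl x A.det := by
    rw [hB, Matrix.det_mul, Matrix.det_mul, ← RingHom.mapMatrix_apply, ← RingHom.map_det,
      ← RingHom.mapMatrix_apply, ← RingHom.map_det, ← AlgHom.mapMatrix_apply,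
      ← AlgHom.map_det, map_mul]
    ring
  -- (3) the constant part.
  have hBconst : constPart B = V * A.map (eval x) * U := by
    rw [hB, constPart_mul, constPart_mul, constPart_map_C, constPart_map_C, constPart_map_transl]
  -- (4) the constant part of `A`: evaluate `B` at `-x`.
  have hBneg : B.map (eval (-x)) = V * constPart A * U := by
    rw [hB, Matrix.map_mul, Matrix.map_mul, map_C_map_eval, map_C_map_eval,
      map_transl_map_eval_neg]
  have hconstA : V * constPart A * U = constPart B - ∑ w, x w • LRPencil.coeffMat B w := by
    rw [← hBneg, LRPencil.map_eval_eq B hBdeg (-x), sub_eq_add_neg, ← Finset.sum_neg_distrib]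
    congr 1
    refine Finset.sum_congr rfl fun w _ => ?_
    rw [Pi.neg_apply, neg_smul]
  exact ⟨hBdeg, hBdet, hBconst, hconstA⟩

end Summit.ValiantsHypothesis.ValiantsHypothesis.Theorems.RefutationDegreeBeyondHessianNs
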